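import Summits.Ventures.QEC.Thresholds.ToricCodeHGPIdentification
import Literature.InformationTheory.QuantumCodes.CSSEquivalenceMixedNoise
import Literature.InformationTheory.QuantumCodes.ToricCodeLossErrorDuality
import HarnessLib

/-!
# The loss–error phase boundary of the census toric object `HGP(circ_L, circ_L)`, both sectors

Venture QEC, `Summits/Ventures/QEC/Thresholds/` (LADDER-QEC rung Q5; qec-type-03 gen 6). The census threshold object of row F4,
`toricHGPCode k = HGP.code (cycMatrix k) (cycMatrix k)` (`L = k + 2`), IS the lattice toric code re-indexed
(`toricHGPCode_eq_reindex`, `ToricCodeHGPIdentification.lean`). The loss–error failure probability of the mixed channel is a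
permutation invariant (`CSSCode.mixedFailureProb_reindex_symm`, `CSSEquivalenceMixedNoise.lean`, with the erasure-aware
decoders transported: `CSSCode.reindexErasureDecoder`), so Stace–Barrett–Doherty's phase boundary of the toric code
(`ToricCode.mixed_accuracyThreshold_pos_iff`, `xMixed_accuracyThreshold_pos_iff`; qec-type-03) holds verbatim for the census
object: for `0 ≤ y ≤ 1` and every family of minimum-weight-outside-the-losses decoders of the `HGP(circ, circ)` codes, the
error accuracy threshold at loss rate `y` is positive iff `y < 1/2`, in the `Z` sector (`toricHGP_z_lossError_accuracyThreshold_pos_iff`)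
and in the `X` sector (`toricHGP_x_lossError_accuracyThreshold_pos_iff`). UNCONDITIONAL, 0 named facts.

## References

* [StaceBarrettDoherty2009] T. M. Stace, S. D. Barrett, A. C. Doherty, PRL 102 (2009) 200501, p. 2–3 and Fig. 2.
* [KovalevPryadko2012] A. A. Kovalev, L. P. Pryadko, ISIT 2012 / arXiv:1202.0928, Example 6 (toric codes as hypergraph products).
* [LinPryadko2024] H.-K. Lin, L. P. Pryadko, PRA 109 (2024) 022407, §4.2 Thm 6 (permutation-equivalent codes).
-/

noncomputable section

namespace Summit.Ventures.QEC.Thresholds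

open Filter Topology Matrix
open Literature.InformationTheory.QuantumCodes
open Literature.InformationTheory.QuantumCodes.ToricCode

/-! ### Pulling decoders of the census object back to the lattice toric code -/

/-- The lattice-toric-code (`Z`-sector) decoder family conjugate to a family of erasure-aware decoders of the census objects
`toricHGPCode k` (index shift `L = k + 1`; at the degenerate size `L + 1 = 1` any canonical decoder).
[cite: KovalevPryadko2012, Example 6 (the identification)] -/
def toricHGPPullbackZ (D' : (k : ℕ) → ErasureDecoder ((Fin (k + 2) × Fin (k + 2)) ⊕ (Fin (k + 2) × Fin (k + 2)))
    (Fin (k + 2) × Fin (k + 2) → ZMod 2)) : (L : ℕ) → ErasureDecoder (Edge (L + 1)) (Syndrome (L + 1))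
  | 0 => ErasureDecoder.minWeightOutside (starMatrix 1)
  | k + 1 => CSSCode.reindexErasureDecoder (toricVertexEquiv k).symm.symm (toricQubitEquiv k).symm.symm (D' k)

/-- The lattice-toric-code `X`-sector decoder family conjugate to a family of erasure-aware `X`-decoders of the census
objects. [cite: KovalevPryadko2012, Example 6] -/
def toricHGPPullbackX (D' : (k : ℕ) → ErasureDecoder ((Fin (k + 2) × Fin (k + 2)) ⊕ (Fin (k + 2) × Fin (k + 2)))
    (Fin (k + 2) × Fin (k + 2) → ZMod 2)) :
    (L : ℕ) → ErasureDecoder (Edge (L + 1)) (Vertex (L + 1) → ZMod 2)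
  | 0 => ErasureDecoder.minWeightOutside (plaquetteMatrix 1)
  | k + 1 => CSSCode.reindexErasureDecoder (toricVertexEquiv k).symm.symm (toricQubitEquiv k).symm.symm (D' k)

/-- **The census object's `Z`-sector loss–error family IS a shifted lattice family** (transport of `mixedFailureProb` along
`toricHGPCode_eq_reindex`). [cite: LinPryadko2024, §4.2 Thm 6] [cite: StaceBarrettDoherty2009, p. 2] -/
theorem toricHGP_zMixedFamily_eq
    (D' : (k : ℕ) → ErasureDecoder ((Fin (k + 2) × Fin (k + 2)) ⊕ (Fin (k + 2) × Fin (k + 2)))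
      (Fin (k + 2) × Fin (k + 2) → ZMod 2)) (y : ℝ) :
    (fun k p => mixedFailureProb (toricHGPCode k).HX ((toricHGPCode k).rowSpZ : Set (_ → ZMod 2)) (D' k) y p) =
      fun k => mixedFamily (toricHGPPullbackZ D') y (k + 1) := by
  funext k p
  rw [toricHGPCode_eq_reindex k, CSSCode.mixedFailureProb_reindex_symm]
  rfl

/-- **The census object's `X`-sector loss–error family IS a shifted lattice `X`-sector family.**
[cite: LinPryadko2024, §4.2 Thm 6(vi) (the CSS-dual code)] [cite: StaceBarrettDoherty2009, p. 2] -/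
theorem toricHGP_xMixedFamily_eq
    (D' : (k : ℕ) → ErasureDecoder ((Fin (k + 2) × Fin (k + 2)) ⊕ (Fin (k + 2) × Fin (k + 2)))
      (Fin (k + 2) × Fin (k + 2) → ZMod 2)) (y : ℝ) :
    (fun k p => mixedFailureProb (toricHGPCode k).HZ ((toricHGPCode k).rowSpX : Set (_ → ZMod 2)) (D' k) y p) =
      fun k p => mixedFailureProb (plaquetteMatrix (k + 1 + 1)) (rowSpace (starMatrix (k + 1 + 1)) : Set (Chain (k + 1 + 1)))
        (toricHGPPullbackX D' (k + 1)) y p := by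
  funext k p
  have h : mixedFailureProb (toricHGPCode k).HZ ((toricHGPCode k).rowSpX : Set (_ → ZMod 2)) (D' k) y p =
      mixedFailureProb (toricHGPCode k).swap.HX ((toricHGPCode k).swap.rowSpZ : Set (_ → ZMod 2)) (D' k) y p := rfl
  rw [h, toricHGPCode_eq_reindex k, CSSCode.reindex_swap, CSSCode.mixedFailureProb_reindex_symm]
  rfl

/-- The pulled-back `Z`-decoders are minimum-weight-outside-the-losses decoders of the lattice toric codes.
[cite: DumerKovalevPryadko2015, Thm 2 (the decoder class)] -/
theorem toricHGPPullbackZ_isMinWeightOutside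
    (D' : (k : ℕ) → ErasureDecoder ((Fin (k + 2) × Fin (k + 2)) ⊕ (Fin (k + 2) × Fin (k + 2)))
      (Fin (k + 2) × Fin (k + 2) → ZMod 2)) (hD' : ∀ k, (D' k).IsMinWeightOutside (toricHGPCode k).HX) :
    ∀ L, (toricHGPPullbackZ D' L).IsMinWeightOutside (starMatrix (L + 1))
  | 0 => minWeightOutside_isMinWeightOutside_toric 1
  | k + 1 => by
    have h := CSSCode.isMinWeightOutside_reindexErasureDecoder_symm (toricCode (k + 2)) (toricVertexEquiv k).symm
      (toricVertexEquiv k).symm (toricQubitEquiv k).symm (D' := D' k) (by rw [← toricHGPCode_eq_reindex]; exact hD' k)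
    exact h

/-- The pulled-back `X`-decoders are minimum-weight-outside-the-losses decoders for the plaquette checks.
[cite: DumerKovalevPryadko2015, Thm 2 (the decoder class)] -/
theorem toricHGPPullbackX_isMinWeightOutside
    (D' : (k : ℕ) → ErasureDecoder ((Fin (k + 2) × Fin (k + 2)) ⊕ (Fin (k + 2) × Fin (k + 2)))
      (Fin (k + 2) × Fin (k + 2) → ZMod 2)) (hD' : ∀ k, (D' k).IsMinWeightOutside (toricHGPCode k).HZ) :
    ∀ L, (toricHGPPullbackX D' L).IsMinWeightOutside (plaquetteMatrix (L + 1))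
  | 0 => ErasureDecoder.minWeightOutside_isMinWeightOutside _
  | k + 1 => by
    have h := CSSCode.isMinWeightOutside_reindexErasureDecoder_symm (toricCode (k + 2)).swap (toricVertexEquiv k).symm
      (toricVertexEquiv k).symm (toricQubitEquiv k).symm (D' := D' k)
      (by rw [← CSSCode.reindex_swap, ← toricHGPCode_eq_reindex]; exact hD' k)
    exact h

/-! ### The phase boundary of the census object -/

/-- ★ **`Z`-sector phase boundary of `HGP(circ_L, circ_L)`**: for `0 ≤ y ≤ 1` and every family of
minimum-weight-outside-the-losses decoders of the census objects, the `Z`-sector error accuracy threshold at loss rate `y` is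
positive iff `y < 1/2`. [cite: StaceBarrettDoherty2009, p. 1 (abstract) and Fig. 2] [cite: KovalevPryadko2012, Example 6] -/
theorem toricHGP_z_lossError_accuracyThreshold_pos_iff
    (D' : (k : ℕ) → ErasureDecoder ((Fin (k + 2) × Fin (k + 2)) ⊕ (Fin (k + 2) × Fin (k + 2)))
      (Fin (k + 2) × Fin (k + 2) → ZMod 2)) (hD' : ∀ k, (D' k).IsMinWeightOutside (toricHGPCode k).HX)
    {y : ℝ} (hy0 : 0 ≤ y) (hy1 : y ≤ 1) :
    0 < accuracyThreshold (fun k p =>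
        mixedFailureProb (toricHGPCode k).HX ((toricHGPCode k).rowSpZ : Set (_ → ZMod 2)) (D' k) y p) ↔ y < 1 / 2 := by
  rw [toricHGP_zMixedFamily_eq, accuracyThreshold_succ (mixedFamily (toricHGPPullbackZ D') y)]
  exact mixed_accuracyThreshold_pos_iff _ (toricHGPPullbackZ_isMinWeightOutside D' hD') hy0 hy1

/-- ★ **`X`-sector phase boundary of `HGP(circ_L, circ_L)`**: the same statement for bit flips detected by the `Z`-checks.
[cite: StaceBarrettDoherty2009, p. 1 (abstract) and Fig. 2] [cite: KovalevPryadko2012, Example 6] -/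
theorem toricHGP_x_lossError_accuracyThreshold_pos_iff
    (D' : (k : ℕ) → ErasureDecoder ((Fin (k + 2) × Fin (k + 2)) ⊕ (Fin (k + 2) × Fin (k + 2)))
      (Fin (k + 2) × Fin (k + 2) → ZMod 2)) (hD' : ∀ k, (D' k).IsMinWeightOutside (toricHGPCode k).HZ)
    {y : ℝ} (hy0 : 0 ≤ y) (hy1 : y ≤ 1) :
    0 < accuracyThreshold (fun k p =>
        mixedFailureProb (toricHGPCode k).HZ ((toricHGPCode k).rowSpX : Set (_ → ZMod 2)) (D' k) y p) ↔ y < 1 / 2 := by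
  rw [toricHGP_xMixedFamily_eq, accuracyThreshold_succ (fun L p => mixedFailureProb (plaquetteMatrix (L + 1))
    (rowSpace (starMatrix (L + 1)) : Set (Chain (L + 1))) (toricHGPPullbackX D' L) y p)]
  exact xMixed_accuracyThreshold_pos_iff _ (toricHGPPullbackX_isMinWeightOutside D' hD') hy0 hy1

/-- **Beyond loss rate `1/2` the census object tolerates no error rate, in either sector, for ANY erasure-aware decoder
family.** [cite: StaceBarrettDoherty2009, p. 2–3 and Fig. 2] -/
theorem toricHGP_lossError_accuracyThreshold_eq_zero
    (D' : (k : ℕ) → ErasureDecoder ((Fin (k + 2) × Fin (k + 2)) ⊕ (Fin (k + 2) × Fin (k + 2)))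
      (Fin (k + 2) × Fin (k + 2) → ZMod 2)) {y : ℝ} (hy : 1 / 2 ≤ y) (hy1 : y ≤ 1) :
    accuracyThreshold (fun k p =>
        mixedFailureProb (toricHGPCode k).HX ((toricHGPCode k).rowSpZ : Set (_ → ZMod 2)) (D' k) y p) = 0 ∧
      accuracyThreshold (fun k p =>
        mixedFailureProb (toricHGPCode k).HZ ((toricHGPCode k).rowSpX : Set (_ → ZMod 2)) (D' k) y p) = 0 := by
  constructor
  · rw [toricHGP_zMixedFamily_eq, accuracyThreshold_succ (mixedFamily (toricHGPPullbackZ D') y)]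
    exact mixed_accuracyThreshold_eq_zero _ hy hy1
  · rw [toricHGP_xMixedFamily_eq, accuracyThreshold_succ (fun L p => mixedFailureProb (plaquetteMatrix (L + 1))
      (rowSpace (starMatrix (L + 1)) : Set (Chain (L + 1))) (toricHGPPullbackX D' L) y p)]
    exact xMixed_accuracyThreshold_eq_zero _ hy hy1

end Summit.Ventures.QEC.Thresholds
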